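import Summits.BirchSwinnertonDyer.BirchSwinnertonDyer.Theorems.ByReductionTypeAtTwoRankOneAtTwoBigImageOddLocalStubShaAnRationalOnSlice
import Literature.NumberTheory.EllipticCurves.GrossZagierRationalPointProofs
import HarnessLib

/-!
# Line `fkl` of crux `RankOneAtTwoBigImageOddLocal` (stmt-BirchSwinnertonDyer-23715, route ByReductionTypeAtTwo):
# stub (5a) `stub_shaAnRationalOnSlice` — `Ш_an ∈ ℚ^×` in analytic rank one, NOW FROM PRIMARY FACTS

Width prover seat `bsd-line-fkl-p2` (g5) under the lead `bsd-line-fkl-p1`; helper file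
`--supports stmt-BirchSwinnertonDyer-23715`, sequel to g0's
`…Theorems/ByReductionTypeAtTwoRankOneAtTwoBigImageOddLocalStubShaAnRationalOnSlice.lean` (p592406), which closed the
registered stub

  `theorem stub_shaAnRationalOnSlice : ∀ (W : WeierstrassCurve ℚ) [W.IsElliptic] [W.IsGloballyMinimal],
      (∀ n : ℕ, W.HasSurjectiveModNGaloisRep ((2 ^ n : ℕ) : ℤ)) → Odd W.torsionOrder → Odd W.tamagawaProduct →
      W.analyticRank = 1 → ∃ q : ℚ, shaAn W = (q : ℂ) ∧ q ≠ 0`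

modulo the two named facts {`GrossZagier1986_thm_I_7_3`, `rank_eq_analyticRank_of_analyticRank_le_one` (GZK)} and
reported «stub-blocked: GrossZagier1986_thm_I_7_3».  That composite named fact (GZ86 Thm. I.(7.3), the `ℚ`-descent of
V.§2) is now a THEOREM of the tree modulo three PRIMARY printed facts — the literature-side
`Literature.NumberTheory.EllipticCurves.GrossZagier1986_thm_I_7_3_of_hoffsteinLuo` (`GrossZagierRationalPointProofs.lean`):
Modularity in the parametrisation form (`nonempty_modularParametrizationData`, BCDT 2001 Thm. A), Hoffstein–Luo 1997
(`HoffsteinLuo1997_exists_twist_L_one_ne_zero`, the tree's proved source of Waldspurger's non-vanishing twist) and the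
Gross–Zagier formula over `K` (`gross_zagier`, GZ86 Thm. V.(2.1) / Cai–Shu–Tian 2014 Thm. 1.1) — every other step of
V.§2 (Birch/Manin–Drinfeld for the odd twist, `‖ω‖² = Ω|Ω⁻|`, `cΩ⁻_f ∈ ℤ|Ω⁻(W)|`, Darmon Prop. 3.11, heights under base
change, Mordell–Weil, `Reg = ĥ(P₀)`) being proved in the tree.  Accordingly:

1. `exists_rat_shaAn_eq_and_ne_zero_of_analyticRank_eq_one_of_primary` — for EVERY elliptic `W/ℚ` of analytic rank one,
   `Ш_an(W) ∈ ℚ^×`, conditional on exactly {BCDT, Hoffstein–Luo, GZ V.(2.1), GZK};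
2. `stub_shaAnRationalOnSlice_of_primary` — the registered signature VERBATIM behind the same four primary facts
   (integration: `stub_shaAnRationalOnSlice := stub_shaAnRationalOnSlice_of_primary hmodP hHL hGZ stub_fklPub.1`, or keep
   g0's `…_of_facts (GrossZagier1986_thm_I_7_3_of_hoffsteinLuo hmodP hHL hGZ) stub_fklPub.1`);
3. `shaAn_ratCast_pos_of_primary` — the sign `0 < q`, with the single extra input `L(E,1) ≥ 0`
   (`re_entireLFunction_one_nonneg`, Guo 1996 / Lapid–Rallis 2003): the positive-constant form
   `gross_zagier_rank_one_rat` used by g0's `shaAn_ratCast_pos_of_facts` is itself a theorem modulo these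
   (`gross_zagier_rank_one_rat_of_nonempty_modularParametrizationData` with Waldspurger from Hoffstein–Luo).

Honest status: (5a) is CLOSED MODULO PRINT, the print now being PRIMARY single theorems (BCDT; Hoffstein–Luo;
Gross–Zagier V.(2.1); Kolyvagin–GZK), none of which has a `_holds` (modular curves / Euler systems / the GZ formula are not
formalised).  Theorems only, no `def`, no new named fact, no `sorry`.  BSD is not proved by any of this.

References: [GrossZagier1986] Thm. I.(7.3) p. 231, V.(2.1) p. 311, V.§2 pp. 312–313 (corpus `paper:url-d19484107fe2`);
[HoffsteinLuo1997] Theorem; [BCDTJAMS2001] Thm. A; [CaiShuTian2014] Thm. 1.1; [Darmon2004] Thm. 3.22 (GZK), Prop. 3.11;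
[Miller2011LMS] §1 (`#Ш_an`).
-/

noncomputable section

open scoped Classical

-- `Summit.BirchSwinnertonDyer.BirchSwinnertonDyer.…` repeats the summit name by the tree's layout (single-conjunct summit).
set_option linter.dupNamespace false

namespace Summit.BirchSwinnertonDyer.BirchSwinnertonDyer.Theorems.RankOneAtTwoFkl

open WeierstrassCurve Literature.NumberTheory.EllipticCurves Literature.NumberTheory.EllipticCurves.ModularForms

/-- **`Ш_an ∈ ℚ^×` in analytic rank one, for every elliptic curve over `ℚ`, from PRIMARY facts**: Modularity
(`hmodP`, BCDT 2001 Thm. A in the parametrisation form), Hoffstein–Luo 1997 (`hHL`), the Gross–Zagier formula over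
`K` (`hGZ`, GZ86 Thm. V.(2.1)) and Gross–Zagier–Kolyvagin (`hGZK`, `rank E(ℚ) = ord_{s=1}L(E,s)` when `≤ 1`).  g0's
`exists_rat_shaAn_eq_and_ne_zero_of_analyticRank_eq_one` with its composite input GZ86 I.(7.3) supplied by the tree's
theorem `GrossZagier1986_thm_I_7_3_of_hoffsteinLuo`.
[cite: GrossZagier1986, Thm. I.(7.3) (p. 231); Thm. V.(2.1); V.§2 (pp. 312–313)] [cite: Darmon2004, Thm. 3.22] -/
theorem exists_rat_shaAn_eq_and_ne_zero_of_analyticRank_eq_one_of_primary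
    (hmodP : nonempty_modularParametrizationData) (hHL : HoffsteinLuo1997_exists_twist_L_one_ne_zero)
    (hGZ : ∀ (N : ℕ) [NeZero N] (W : WeierstrassCurve ℚ) (K : Type) [Field K] [NumberField K],
      gross_zagier N W K)
    (hGZK : rank_eq_analyticRank_of_analyticRank_le_one) (W : WeierstrassCurve ℚ) [W.IsElliptic]
    (hr : W.analyticRank = 1) : ∃ q : ℚ, shaAn W = (q : ℂ) ∧ q ≠ 0 :=
  exists_rat_shaAn_eq_and_ne_zero_of_analyticRank_eq_one
    (GrossZagier1986_thm_I_7_3_of_hoffsteinLuo hmodP hHL hGZ) hGZK W hr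

/-- **Stub (5a) of line `fkl`, verbatim, behind PRIMARY printed inputs.**  The registered signature of
`stub_shaAnRationalOnSlice` (crux `RankOneAtTwoBigImageOddLocal`, skeleton `Lines/fkl.lean`) from Modularity (`hmodP`),
Hoffstein–Luo (`hHL`), Gross–Zagier V.(2.1) over `K` (`hGZ`) and GZK (`hGZK` = `stub_fklPub.1`); the slice binders are
idle.  Replaces the composite citation GZ86 I.(7.3) of g0's `stub_shaAnRationalOnSlice_of_facts` by its proof.
Status: CONDITIONAL on these four primary named facts (none has a `_holds`).
[cite: GrossZagier1986, Thm. I.(7.3) (p. 231); V.§2 (pp. 312–313)] [cite: Darmon2004, Thm. 3.22] -/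
theorem stub_shaAnRationalOnSlice_of_primary
    (hmodP : nonempty_modularParametrizationData) (hHL : HoffsteinLuo1997_exists_twist_L_one_ne_zero)
    (hGZ : ∀ (N : ℕ) [NeZero N] (W : WeierstrassCurve ℚ) (K : Type) [Field K] [NumberField K],
      gross_zagier N W K)
    (hGZK : rank_eq_analyticRank_of_analyticRank_le_one) :
    ∀ (W : WeierstrassCurve ℚ) [W.IsElliptic] [W.IsGloballyMinimal],
      (∀ n : ℕ, W.HasSurjectiveModNGaloisRep ((2 ^ n : ℕ) : ℤ)) → Odd W.torsionOrder → Odd W.tamagawaProduct →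
      W.analyticRank = 1 → ∃ q : ℚ, shaAn W = (q : ℂ) ∧ q ≠ 0 :=
  stub_shaAnRationalOnSlice_of_facts (GrossZagier1986_thm_I_7_3_of_hoffsteinLuo hmodP hHL hGZ) hGZK

/-- **The sign of the witness from primary facts.**  `Ш_an(W) > 0` (as a rational) in analytic rank one, modulo
Modularity (`hmodP`), Hoffstein–Luo (`hHL`), Gross–Zagier V.(2.1) (`hGZ`), GZK (`hGZK`) and `L(E,1) ≥ 0` (`hL0`,
Guo 1996 / Lapid–Rallis 2003): g0's `shaAn_ratCast_pos_of_facts` with GZ86 I.(7.3) from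
`GrossZagier1986_thm_I_7_3_of_hoffsteinLuo`, modularity in Version `L` from the parametrisation form
(`hasEntireLFunction_rat_of_exists_isNewformOf ∘ exists_isNewformOf_of_nonempty_modularParametrizationData`), and the
positive-constant rank-one fact `gross_zagier_rank_one_rat` from
`gross_zagier_rank_one_rat_of_nonempty_modularParametrizationData` with Waldspurger's twist supplied by Hoffstein–Luo
(`waldspurger_exists_heegnerField_twist_ne_zero_of_hoffsteinLuo`).
[cite: GrossZagier1986, Thm. I.6.3, Thm. I.(7.3) and §V.2] [cite: Miller2011LMS, §1 and §4] -/
theorem shaAn_ratCast_pos_of_primary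
    (hmodP : nonempty_modularParametrizationData) (hHL : HoffsteinLuo1997_exists_twist_L_one_ne_zero)
    (hGZ : ∀ (N : ℕ) [NeZero N] (W : WeierstrassCurve ℚ) (K : Type) [Field K] [NumberField K],
      gross_zagier N W K)
    (hGZK : rank_eq_analyticRank_of_analyticRank_le_one) (hL0 : re_entireLFunction_one_nonneg)
    (W : WeierstrassCurve ℚ) [W.IsElliptic] (hr : W.analyticRank = 1) :
    ∃ q : ℚ, shaAn W = (q : ℂ) ∧ 0 < q :=
  have hmod : exists_isNewformOf := exists_isNewformOf_of_nonempty_modularParametrizationData hmodP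
  shaAn_ratCast_pos_of_facts (GrossZagier1986_thm_I_7_3_of_hoffsteinLuo hmodP hHL hGZ) hGZK
    (hasEntireLFunction_rat_of_exists_isNewformOf hmod) hL0
    (gross_zagier_rank_one_rat_of_nonempty_modularParametrizationData hmodP
      (waldspurger_exists_heegnerField_twist_ne_zero_of_hoffsteinLuo hmod hHL) hGZ hL0) W hr

end Summit.BirchSwinnertonDyer.BirchSwinnertonDyer.Theorems.RankOneAtTwoFkl

end
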